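import Literature.NumberTheory.LFunctions.RudnickSarnakNUnsmoothing
import HarnessLib

/-!
# Rudnick–Sarnak `n`-level correlations for `ζ`: the renormalisation `Lγ/2π ↦ γ̃`

Sibling file of `Literature/NumberTheory/LFunctions/RudnickSarnak.lean` (toward
`Literature.NumberTheory.LFunctions.rudnick_sarnak_unrestricted`, Rudnick–Sarnak 1996, Theorem 3.2
for `ζ`, at every level; back end). Rudnick–Sarnak 1996, pp. 303–304, (3.75)–(3.77): "we need
to discuss the passage from the normalization of zeros `(L/2π)γ` appearing in the definition of the
smooth sums … and the normalization `γ̃ = (γ/2π) log γ` initially used to define `C_n(f, T)` … we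
claim that `C_n(Φ, T) − C̃_n(Φ, T) = o(TL)`" — proved there for `n = 2` by the mean value theorem
and a majorant, "the general case being similar". Here, at every level `n = k + 1`:

  `‖Σ_{m ∈ [0,N(T))ⁿ} f_Φ(γ̃_m) − Σ_{m ∈ [0,N(T))ⁿ} f_Φ(Lγ_m/2π)‖ ≤ ε T log T`   (`T ≥ T₀(ε)`)

(`RudnickSarnakN.Unsmooth.exists_norm_sharpN_sub_sharpL_le`), where the first sum is
`unrestrictedLevelSum (k+1) (rsPhiTest Φ) (N(T))` (`RudnickSarnakN.Unsmooth.sharpN_eq`). Tuples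
with a low first member (`γ_{m_0} < 2T/L^{k+2}`) are few (pointwise unit-window bounds in both
normalisations); tuples with a high first member and a far other member are negligible by decay;
on the remaining tuples the two normalisations differ by a factor `1 + O(log log T/log T)` in every
coordinate and the mean value estimate of `RudnickSarnakNTestDecay.lean` applies, the resulting
sum being `O(TL)` by the key lemma of `RudnickSarnakNMoments.lean`.

## References

* Z. Rudnick, P. Sarnak, *Zeros of principal `L`-functions and random matrix theory*, Duke Math.
  J. 81 (1996), 269–322, Thm. 3.2, (3.75)–(3.77).
-/

noncomputable section

open Complex Filter Set MeasureTheory Finset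
open scoped Real Topology ContDiff

namespace Literature.NumberTheory.LFunctions

namespace RudnickSarnakN

namespace Unsmooth

variable {k : ℕ}

/-! ## The sharp sum in the normalisation `γ̃` -/

/-- The test factor in the normalisation `γ̃ = γ log γ/2π`: `f_Φ(γ̃_m)`. [cite: RudnickSarnak1996, (3.2)] -/
def gT (Φ : (Fin (k + 1) → ℝ) → ℂ) (m : Fin (k + 1) → ℕ) : ℂ :=
  rsPhiTest Φ (fun j ↦ normalizedOrdinate (m j))

/-- The sharp sum `C_n(f_Φ, T) = Σ_{m ∈ [0,N(T))ⁿ} f_Φ(γ̃_m)` over the box. [cite: RudnickSarnak1996, (3.2)] -/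
def sharpN (Φ : (Fin (k + 1) → ℝ) → ℂ) (T : ℝ) : ℂ :=
  ∑ m ∈ box k (zetaZeroCount T), gT Φ m

/-- **`unrestrictedLevelSum` is the box sum** (tuples `Fin n → Fin N` versus tuples of naturals
below `N`). [cite: RudnickSarnak1996, (3.2)] -/
theorem sharpN_eq (Φ : (Fin (k + 1) → ℝ) → ℂ) (T : ℝ) :
    unrestrictedLevelSum (k + 1) (rsPhiTest Φ) (zetaZeroCount T) = sharpN Φ T := by
  unfold unrestrictedLevelSum sharpN gT box
  set N := zetaZeroCount T
  refine Finset.sum_bij (fun (i : Fin (k + 1) → Fin N) _ ↦ fun j ↦ ((i j : Fin N) : ℕ)) ?_ ?_ ?_ ?_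
  · intro i _
    rw [Fintype.mem_piFinset]
    intro j
    exact Finset.mem_range.2 (i j).isLt
  · intro i₁ _ i₂ _ h
    funext j
    exact Fin.ext (congrFun h j)
  · intro m hm
    rw [Fintype.mem_piFinset] at hm
    refine ⟨fun j ↦ ⟨m j, Finset.mem_range.1 (hm j)⟩, Finset.mem_univ _, ?_⟩
    funext j; rfl
  · intro i _
    rfl

/-- `f_Φ(γ̃_m) = Ψ_Φ(z̃_m)`, `z̃_m = (γ̃_{m_{i+1}} − γ̃_{m_0})_i`. [cite: RudnickSarnak1996, (3.6)] -/
theorem gT_eq_psiFn (Φ : (Fin (k + 1) → ℝ) → ℂ) (m : Fin (k + 1) → ℕ) :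
    gT Φ m = psiFn Φ (fun i ↦ normalizedOrdinate (m i.succ) - normalizedOrdinate (m 0)) := by
  unfold gT; rw [rsPhiTest_eq_psiFn]

/-! ## The two normalisations on high pairs -/

/-- **The two normalisations agree on high pairs** (the mean value theorem of RS (3.77)): for
`0 < T_l ≤ a, b ≤ T` and `L = log T`,
`|b log b − a log a − L(b − a)| ≤ (log(T/T_l) + 1)|b − a|`. [cite: RudnickSarnak1996, (3.77)] -/
theorem abs_renorm_sub_le_general {T Tl a b : ℝ} (hTl : 0 < Tl) (ha : Tl ≤ a) (hb : Tl ≤ b) (haT : a ≤ T) (hbT : b ≤ T) :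
    |b * Real.log b - a * Real.log a - Real.log T * (b - a)| ≤ (Real.log (T / Tl) + 1) * |b - a| := by
  -- reduce to `a ≤ b`
  wlog hab : a ≤ b generalizing a b
  · have h := this hb ha hbT haT (le_of_not_ge hab)
    rw [show a * Real.log a - b * Real.log b - Real.log T * (a - b) = -(b * Real.log b - a * Real.log a - Real.log T * (b - a)) by ring,
      abs_neg, abs_sub_comm a b] at h
    exact h
  have ha0 : 0 < a := hTl.trans_le ha
  have hb0 : 0 < b := hTl.trans_le hb
  have hT0 : 0 < T := ha0.trans_le haT
  -- `0 ≤ a (log b − log a) ≤ b − a`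
  have h1 : 0 ≤ a * (Real.log b - Real.log a) := mul_nonneg ha0.le (by linarith [Real.log_le_log ha0 hab])
  have h2 : a * (Real.log b - Real.log a) ≤ b - a := by
    rw [← Real.log_div hb0.ne' ha0.ne']
    have := Real.log_le_sub_one_of_pos (show 0 < b / a by positivity)
    calc a * Real.log (b / a) ≤ a * (b / a - 1) := mul_le_mul_of_nonneg_left this ha0.le
      _ = b - a := by field_simp
  -- `L − log(T/Tl) ≤ log b ≤ L`
  have h3 : Real.log b ≤ Real.log T := Real.log_le_log hb0 hbT
  have h4 : Real.log T - Real.log (T / Tl) ≤ Real.log b := by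
    rw [Real.log_div hT0.ne' hTl.ne']
    linarith [Real.log_le_log hTl hb]
  have hlog0 : 0 ≤ Real.log (T / Tl) := Real.log_nonneg ((one_le_div hTl).2 (hb.trans hbT))
  rw [abs_of_nonneg (by linarith : 0 ≤ b - a)]
  have e : b * Real.log b - a * Real.log a - Real.log T * (b - a) =
      (b - a) * (Real.log b - Real.log T) + a * (Real.log b - Real.log a) := by ring
  rw [e, abs_le]
  constructor <;> nlinarith

/-! ## Shell sums from unit-window bounds -/

/-- **Shell bound**: if every unit window `[b, b+1]` contains at most `B` of the points `x_n`
(`n ∈ S`) then for every centre `x₀` and every `c ≥ 1`,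
`Σ_{n ∈ S} (1 + c|x_n − x₀|)^{-3} ≤ 6B`. [folklore] -/
theorem sum_inv_cube_le_of_unitWindow {S : Finset ℕ} {x : ℕ → ℝ} {B : ℝ}
    (hB : ∀ b : ℝ, ((S.filter fun n ↦ b ≤ x n ∧ x n ≤ b + 1).card : ℝ) ≤ B) {c : ℝ} (hc : 1 ≤ c) (x₀ : ℝ) :
    ∑ n ∈ S, ((1 + c * |x n - x₀|) ^ 3)⁻¹ ≤ 6 * B := by
  classical
  have hB0 : 0 ≤ B := le_trans (Nat.cast_nonneg _) (hB 0)
  -- shells `⌊|x_n − x₀|⌋ = d`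
  set sh : ℕ → ℕ := fun n ↦ ⌊|x n - x₀|⌋₊
  obtain ⟨D, hD⟩ : ∃ D : ℕ, ∀ n ∈ S, sh n < D :=
    ⟨S.sup sh + 1, fun n hn ↦ Nat.lt_succ_of_le (Finset.le_sup hn)⟩
  have hmaps : ∀ n ∈ S, sh n ∈ Finset.range D := fun n hn ↦ Finset.mem_range.2 (hD n hn)
  -- pointwise: weight `≤ (1 + sh n)^{-2}`
  have hpt : ∀ n ∈ S, ((1 + c * |x n - x₀|) ^ 3)⁻¹ ≤ (((sh n : ℝ) + 1) ^ 2)⁻¹ := by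
    intro n _
    have hfl : (sh n : ℝ) ≤ |x n - x₀| := Nat.floor_le (abs_nonneg _)
    have h1 : (sh n : ℝ) + 1 ≤ 1 + c * |x n - x₀| := by nlinarith [abs_nonneg (x n - x₀)]
    have h0 : (0 : ℝ) < (sh n : ℝ) + 1 := by positivity
    calc ((1 + c * |x n - x₀|) ^ 3)⁻¹ ≤ (((sh n : ℝ) + 1) ^ 3)⁻¹ := inv_anti₀ (pow_pos h0 3) (pow_le_pow_left₀ h0.le h1 3)
      _ ≤ (((sh n : ℝ) + 1) ^ 2)⁻¹ := inv_anti₀ (pow_pos h0 2) (pow_le_pow_right₀ (by linarith) (by norm_num))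
  -- each shell has at most `2B` points
  have hshell : ∀ d : ℕ, ((S.filter fun n ↦ sh n = d).card : ℝ) ≤ 2 * B := by
    intro d
    have hsub : (S.filter fun n ↦ sh n = d) ⊆ (S.filter fun n ↦ x₀ + d ≤ x n ∧ x n ≤ x₀ + d + 1) ∪
        (S.filter fun n ↦ x₀ - d - 1 ≤ x n ∧ x n ≤ x₀ - d - 1 + 1) := by
      intro n hn
      rw [Finset.mem_filter] at hn
      obtain ⟨hnS, hnd⟩ := hn
      have hfl : (d : ℝ) ≤ |x n - x₀| := by rw [← hnd]; exact Nat.floor_le (abs_nonneg _)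
      have hlt : |x n - x₀| < d + 1 := by rw [← hnd]; exact Nat.lt_floor_add_one _
      rw [Finset.mem_union, Finset.mem_filter, Finset.mem_filter]
      rcases le_or_gt 0 (x n - x₀) with h | h
      · left; rw [abs_of_nonneg h] at hfl hlt; exact ⟨hnS, by linarith, by linarith⟩
      · right; rw [abs_of_neg h] at hfl hlt; exact ⟨hnS, by linarith, by linarith⟩
    calc ((S.filter fun n ↦ sh n = d).card : ℝ)
        ≤ (((S.filter fun n ↦ x₀ + d ≤ x n ∧ x n ≤ x₀ + d + 1) ∪
            (S.filter fun n ↦ x₀ - d - 1 ≤ x n ∧ x n ≤ x₀ - d - 1 + 1)).card : ℝ) := by exact_mod_cast Finset.card_le_card hsub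
      _ ≤ ((S.filter fun n ↦ x₀ + d ≤ x n ∧ x n ≤ x₀ + d + 1).card : ℝ) +
          ((S.filter fun n ↦ x₀ - d - 1 ≤ x n ∧ x n ≤ x₀ - d - 1 + 1).card : ℝ) := by exact_mod_cast Finset.card_union_le _ _
      _ ≤ B + B := add_le_add (hB _) (hB _)
      _ = 2 * B := by ring
  calc ∑ n ∈ S, ((1 + c * |x n - x₀|) ^ 3)⁻¹ ≤ ∑ n ∈ S, (((sh n : ℝ) + 1) ^ 2)⁻¹ := Finset.sum_le_sum hpt
    _ = ∑ d ∈ Finset.range D, ∑ n ∈ S with sh n = d, (((d : ℝ) + 1) ^ 2)⁻¹ :=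
        (Finset.sum_fiberwise_of_maps_to' hmaps (fun d ↦ (((d : ℝ) + 1) ^ 2)⁻¹)).symm
    _ = ∑ d ∈ Finset.range D, ((S.filter fun n ↦ sh n = d).card : ℝ) * (((d : ℝ) + 1) ^ 2)⁻¹ := by
        refine Finset.sum_congr rfl fun d _ ↦ ?_; rw [Finset.sum_const, nsmul_eq_mul]
    _ ≤ ∑ d ∈ Finset.range D, 2 * B * (((d : ℝ) + 1) ^ 2)⁻¹ :=
        Finset.sum_le_sum fun d _ ↦ mul_le_mul_of_nonneg_right (hshell d) (by positivity)
    _ = 2 * B * ∑ d ∈ Finset.range D, (((d : ℝ) + 1) ^ 2)⁻¹ := by rw [Finset.mul_sum]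
    _ ≤ 2 * B * 3 := mul_le_mul_of_nonneg_left (sum_range_inv_succ_sq_le D) (by positivity)
    _ = 6 * B := by ring

/-! ## Decay in the normalisation `γ̃` -/

/-- The weight `w̃(a, n) = (1 + |γ̃_n − γ̃_a|)^{-3}`. [folklore] -/
def wt3 (a n : ℕ) : ℝ := ((1 + |normalizedOrdinate n - normalizedOrdinate a|) ^ 3)⁻¹

/-- `|γ̃_n − γ̃_a| ≥ |γ_n − γ_a|/π` (the normalisation expands distances; `log γ ≥ 2`).
[cite: RudnickSarnak1996, (3.77)] -/
theorem abs_sub_div_pi_le_abs_normalizedOrdinate_sub (a n : ℕ) :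
    |zetaOrdinate n - zetaOrdinate a| / π ≤ |normalizedOrdinate n - normalizedOrdinate a| := by
  rcases le_total (zetaOrdinate a) (zetaOrdinate n) with h | h
  · have := RudnickSarnak.sub_div_pi_le_of_two_le_log (zetaOrdinate_pos_holds a) h (RudnickSarnak.two_le_log_zetaOrdinate a)
    unfold normalizedOrdinate
    have h0 : 0 ≤ (zetaOrdinate n - zetaOrdinate a) / π := div_nonneg (by linarith) Real.pi_pos.le
    rw [abs_of_nonneg (by linarith), abs_of_nonneg (h0.trans this)]
    exact this
  · have := RudnickSarnak.sub_div_pi_le_of_two_le_log (zetaOrdinate_pos_holds n) h (RudnickSarnak.two_le_log_zetaOrdinate n)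
    unfold normalizedOrdinate
    have h0 : 0 ≤ (zetaOrdinate a - zetaOrdinate n) / π := div_nonneg (by linarith) Real.pi_pos.le
    rw [abs_of_nonpos (by linarith), abs_of_nonpos (by linarith [h0.trans this]), neg_sub, neg_sub]
    exact this

/-! ## The renormalisation estimate: the finite form -/

/-- Unit-window bounds pass to subsets. [folklore] -/
theorem unitWindow_mono {S S' : Finset ℕ} (hSS' : S ⊆ S') {x : ℕ → ℝ} {B : ℝ}
    (hB : ∀ b : ℝ, ((S'.filter fun n ↦ b ≤ x n ∧ x n ≤ b + 1).card : ℝ) ≤ B) (b : ℝ) :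
    ((S.filter fun n ↦ b ≤ x n ∧ x n ≤ b + 1).card : ℝ) ≤ B :=
  le_trans (by exact_mod_cast Finset.card_le_card (Finset.filter_subset_filter _ hSS')) (hB b)

/-- **The renormalisation estimate, finite form.** For `Φ` smooth of compact support, with the
decay constants `C₃` (`a = 3`), `C_a` (`a = k+2`) and the mean-value constant `C_r` of `Ψ_Φ`: let
`T ≥ 3` with `L = log T ≥ 2π`, `0 < T_l` with `2T_l ≤ T`, `τ = (log(T/T_l) + 1)/L ≤ 1/2`, and
unit-window bounds `B` (ordinates below `N(T+3)`) and `B̃` (normalised ordinates below `N(T)`). Then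

  `‖S̃(T) − S'(T)‖ ≤ C_r τ Σ_{boxP} Π w + N(T)^{k+1} C_a (δ + δ') + #{a < N(T) : γ_a < 2T_l} C₃ ((6B)^k + (6B̃)^k)`

with `δ = (1 + L T_l/2π)^{-(k+2)}`, `δ' = (1 + T_l/π)^{-(k+2)}`. [cite: RudnickSarnak1996, (3.75)–(3.77)] -/
theorem norm_sharpN_sub_sharpL_le_explicit {Φ : (Fin (k + 1) → ℝ) → ℂ} {C₃ Ca Cr : ℝ}
    (hC₃0 : 0 ≤ C₃) (hC₃ : ∀ y : Fin k → ℝ, ‖psiFn Φ y‖ ≤ C₃ * ∏ i, ((1 + |y i|) ^ 3)⁻¹)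
    (hCa0 : 0 ≤ Ca) (hCa : ∀ y : Fin k → ℝ, ‖psiFn Φ y‖ ≤ Ca * ∏ i, ((1 + |y i|) ^ (k + 2))⁻¹)
    (hCr0 : 0 ≤ Cr) (hCr : ∀ (τ : ℝ), 0 ≤ τ → τ ≤ 1 / 2 → ∀ y y' : Fin k → ℝ,
      (∀ i, |y' i - y i| ≤ τ * |y i|) → ‖psiFn Φ y' - psiFn Φ y‖ ≤ Cr * τ * ∏ i, ((1 + |y i|) ^ 3)⁻¹)
    {T Tl B Bt : ℝ} (hT : 3 ≤ T) (hL : 2 * π ≤ Real.log T) (hTl : 0 < Tl) (hTlT : 2 * Tl ≤ T)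
    (hτ : (Real.log (T / Tl) + 1) / Real.log T ≤ 1 / 2)
    (hB : ∀ b : ℝ, (((Finset.range (zetaZeroCount (T + 3))).filter fun n ↦
        b ≤ zetaOrdinate n ∧ zetaOrdinate n ≤ b + 1).card : ℝ) ≤ B)
    (hBt : ∀ b : ℝ, (((Finset.range (zetaZeroCount T)).filter fun n ↦
        b ≤ normalizedOrdinate n ∧ normalizedOrdinate n ≤ b + 1).card : ℝ) ≤ Bt) :
    ‖sharpN Φ T - sharpL Φ T‖ ≤
      Cr * ((Real.log (T / Tl) + 1) / Real.log T) * ∑ m ∈ boxP k T, ∏ i : Fin k, w3 T (m 0) (m i.succ) +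
      (zetaZeroCount T : ℝ) ^ (k + 1) * (Ca * (((1 + Real.log T * Tl / (2 * π)) ^ (k + 2))⁻¹ + ((1 + Tl / π) ^ (k + 2))⁻¹)) +
      (((Finset.range (zetaZeroCount T)).filter fun a ↦ zetaOrdinate a < 2 * Tl).card : ℝ) *
        (C₃ * ((6 * B) ^ k + (6 * Bt) ^ k)) := by
  classical
  set N := zetaZeroCount T
  set L := Real.log T
  set Bx := box k N
  set τ := (Real.log (T / Tl) + 1) / L
  set δ : ℝ := ((1 + L * Tl / (2 * π)) ^ (k + 2))⁻¹
  set δ' : ℝ := ((1 + Tl / π) ^ (k + 2))⁻¹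
  have hT0 : (0 : ℝ) < T := by linarith
  have hL1 : 1 ≤ L := le_trans (by linarith [Real.pi_gt_three]) hL
  have hL0 : 0 ≤ L := by linarith
  have hlogTl : 0 ≤ Real.log (T / Tl) := Real.log_nonneg ((one_le_div hTl).2 (by linarith))
  have hτ0 : 0 ≤ τ := by positivity
  have hB0 : 0 ≤ B := le_trans (Nat.cast_nonneg _) (hB 0)
  have hBt0 : 0 ≤ Bt := le_trans (Nat.cast_nonneg _) (hBt 0)
  -- the difference as a sum over the box
  have hdiff : sharpN Φ T - sharpL Φ T = ∑ m ∈ Bx, (gT Φ m - fT Φ T m) := by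
    unfold sharpN sharpL; rw [Finset.sum_sub_distrib]
  rw [hdiff]
  -- classes
  set low : (Fin (k + 1) → ℕ) → Prop := fun m ↦ zetaOrdinate (m 0) < 2 * Tl
  set near : (Fin (k + 1) → ℕ) → Prop := fun m ↦ ∀ i : Fin k, |zetaOrdinate (m i.succ) - zetaOrdinate (m 0)| ≤ Tl
  -- the two coordinate vectors
  set z : (Fin (k + 1) → ℕ) → (Fin k → ℝ) := fun m i ↦ L * (zetaOrdinate (m i.succ) - zetaOrdinate (m 0)) / (2 * π)
  set zt : (Fin (k + 1) → ℕ) → (Fin k → ℝ) := fun m i ↦ normalizedOrdinate (m i.succ) - normalizedOrdinate (m 0)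
  have hfz : ∀ m, fT Φ T m = psiFn Φ (z m) := fun m ↦ fT_eq_psiFn Φ T m
  have hgz : ∀ m, gT Φ m = psiFn Φ (zt m) := fun m ↦ gT_eq_psiFn Φ m
  have habsz : ∀ m i, |z m i| = nd T (m 0) (m i.succ) := by
    intro m i
    simp only [z, nd]
    rw [abs_div, abs_mul, abs_of_nonneg hL0, abs_of_pos (by positivity : (0 : ℝ) < 2 * π)]
  -- (t1) high and near: the mean value estimate
  have ht1 : ∀ m ∈ Bx, ¬ low m → near m → ‖gT Φ m - fT Φ T m‖ ≤ Cr * τ * ∏ i : Fin k, w3 T (m 0) (m i.succ) := by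
    intro m hm hlow hnear
    rw [mem_box] at hm
    simp only [low, not_lt] at hlow
    have ha : Tl ≤ zetaOrdinate (m 0) := by linarith
    have haT : zetaOrdinate (m 0) ≤ T := lt_zetaZeroCount_iff.1 (hm 0)
    have hcoord : ∀ i, |zt m i - z m i| ≤ τ * |z m i| := by
      intro i
      have hbT : zetaOrdinate (m i.succ) ≤ T := lt_zetaZeroCount_iff.1 (hm i.succ)
      have hb : Tl ≤ zetaOrdinate (m i.succ) := by
        have := (abs_le.1 (hnear i)).1; linarith
      have hmv := abs_renorm_sub_le_general (T := T) hTl ha hb haT hbT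
      have e1 : zt m i - z m i = (zetaOrdinate (m i.succ) * Real.log (zetaOrdinate (m i.succ)) -
          zetaOrdinate (m 0) * Real.log (zetaOrdinate (m 0)) - L * (zetaOrdinate (m i.succ) - zetaOrdinate (m 0))) / (2 * π) := by
        simp only [zt, z, normalizedOrdinate]; ring
      have e2 : τ * |z m i| = (Real.log (T / Tl) + 1) * |zetaOrdinate (m i.succ) - zetaOrdinate (m 0)| / (2 * π) := by
        simp only [τ, z]
        rw [abs_div, abs_mul, abs_of_nonneg hL0, abs_of_pos (by positivity : (0 : ℝ) < 2 * π)]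
        field_simp
      rw [e1, e2, abs_div, abs_of_pos (by positivity : (0 : ℝ) < 2 * π)]
      exact div_le_div_of_nonneg_right hmv (by positivity)
    rw [hgz, hfz]
    refine (hCr τ hτ0 hτ (z m) (zt m) hcoord).trans (le_of_eq ?_)
    congr 1
    refine Finset.prod_congr rfl fun i _ ↦ ?_
    rw [habsz, w3_eq]
  -- (t2) high and far: one tiny factor
  have ht2 : ∀ m ∈ Bx, ¬ low m → ¬ near m → ‖gT Φ m - fT Φ T m‖ ≤ Ca * (δ + δ') := by
    intro m _ hlow hnear
    simp only [near, not_forall, not_le] at hnear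
    obtain ⟨i₀, hi₀⟩ := hnear
    have hone : ∀ (y : Fin k → ℝ) (a : ℕ), ∏ i, ((1 + |y i|) ^ a)⁻¹ ≤ ((1 + |y i₀|) ^ a)⁻¹ := by
      intro y a
      rw [← Finset.prod_erase_mul _ _ (Finset.mem_univ i₀)]
      refine mul_le_of_le_one_left (by positivity) (Finset.prod_le_one (fun i _ ↦ by positivity) fun i _ ↦ ?_)
      exact inv_le_one_of_one_le₀ (one_le_pow₀ (by linarith [abs_nonneg (y i)]))
    have hf : ‖fT Φ T m‖ ≤ Ca * δ := by
      rw [hfz]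
      refine (hCa _).trans (mul_le_mul_of_nonneg_left ((hone (z m) (k + 2)).trans ?_) hCa0)
      refine inv_anti₀ (by positivity) (pow_le_pow_left₀ (by positivity) ?_ _)
      rw [habsz]; unfold nd
      have : L * Tl ≤ L * |zetaOrdinate (m i₀.succ) - zetaOrdinate (m 0)| := mul_le_mul_of_nonneg_left hi₀.le hL0
      have := div_le_div_of_nonneg_right this (by positivity : (0 : ℝ) ≤ 2 * π)
      linarith
    have hg : ‖gT Φ m‖ ≤ Ca * δ' := by
      rw [hgz]
      refine (hCa _).trans (mul_le_mul_of_nonneg_left ((hone (zt m) (k + 2)).trans ?_) hCa0)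
      refine inv_anti₀ (by positivity) (pow_le_pow_left₀ (by positivity) ?_ _)
      have h1 := abs_sub_div_pi_le_abs_normalizedOrdinate_sub (m 0) (m i₀.succ)
      have h2 : Tl / π ≤ |zetaOrdinate (m i₀.succ) - zetaOrdinate (m 0)| / π := div_le_div_of_nonneg_right hi₀.le Real.pi_pos.le
      simp only [zt]; linarith
    calc ‖gT Φ m - fT Φ T m‖ ≤ ‖gT Φ m‖ + ‖fT Φ T m‖ := norm_sub_le _ _
      _ ≤ Ca * δ' + Ca * δ := add_le_add hg hf
      _ = Ca * (δ + δ') := by ring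
  -- (t3) low: product bounds in both normalisations
  have ht3 : ∀ m, ‖gT Φ m - fT Φ T m‖ ≤ C₃ * ∏ i : Fin k, wt3 (m 0) (m i.succ) + C₃ * ∏ i : Fin k, w3 T (m 0) (m i.succ) := by
    intro m
    calc ‖gT Φ m - fT Φ T m‖ ≤ ‖gT Φ m‖ + ‖fT Φ T m‖ := norm_sub_le _ _
      _ ≤ C₃ * ∏ i : Fin k, wt3 (m 0) (m i.succ) + C₃ * ∏ i : Fin k, w3 T (m 0) (m i.succ) := by
          refine add_le_add ?_ ?_
          · rw [hgz]; refine (hC₃ _).trans (le_of_eq ?_); rfl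
          · rw [hfz]; refine (hC₃ _).trans (le_of_eq ?_)
            congr 1; refine Finset.prod_congr rfl fun i _ ↦ ?_; rw [habsz, w3_eq]
  -- pointwise shell bounds
  have hc : 1 ≤ L / (2 * π) := by rw [le_div_iff₀ (by positivity)]; linarith
  have hshell : ∀ a, ∑ n ∈ Finset.range N, w3 T a n ≤ 6 * B := by
    intro a
    have hB' := unitWindow_mono (Finset.range_subset_range.2 (zetaZeroCount_mono (by linarith : T ≤ T + 3))) hB
    have h := sum_inv_cube_le_of_unitWindow (S := Finset.range N) (x := zetaOrdinate) hB' hc (zetaOrdinate a)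
    refine le_trans (le_of_eq (Finset.sum_congr rfl fun n _ ↦ ?_)) h
    unfold w3; congr 2; ring
  have hshellt : ∀ a, ∑ n ∈ Finset.range N, wt3 a n ≤ 6 * Bt := by
    intro a
    have h := sum_inv_cube_le_of_unitWindow (S := Finset.range N) (x := normalizedOrdinate) hBt le_rfl (normalizedOrdinate a)
    simpa only [wt3, one_mul] using h
  -- split the sum
  have hsplit : ‖∑ m ∈ Bx, (gT Φ m - fT Φ T m)‖ ≤
      ∑ m ∈ Bx.filter (fun m ↦ ¬ low m ∧ near m), ‖gT Φ m - fT Φ T m‖ +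
      ∑ m ∈ Bx.filter (fun m ↦ ¬ low m ∧ ¬ near m), ‖gT Φ m - fT Φ T m‖ +
      ∑ m ∈ Bx.filter (fun m ↦ low m), ‖gT Φ m - fT Φ T m‖ := by
    refine (norm_sum_le _ _).trans (le_of_eq ?_)
    rw [← Finset.sum_filter_add_sum_filter_not Bx (fun m ↦ low m)]
    rw [← Finset.sum_filter_add_sum_filter_not (Bx.filter fun m ↦ ¬ low m) (fun m ↦ near m)]
    rw [Finset.filter_filter, Finset.filter_filter]
    ring
  refine hsplit.trans (add_le_add (add_le_add ?_ ?_) ?_)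
  · -- (t1)
    calc ∑ m ∈ Bx.filter (fun m ↦ ¬ low m ∧ near m), ‖gT Φ m - fT Φ T m‖
        ≤ ∑ m ∈ Bx.filter (fun m ↦ ¬ low m ∧ near m), Cr * τ * ∏ i : Fin k, w3 T (m 0) (m i.succ) :=
          Finset.sum_le_sum fun m hm ↦ by
            rw [Finset.mem_filter] at hm; exact ht1 m hm.1 hm.2.1 hm.2.2
      _ ≤ ∑ m ∈ boxP k T, Cr * τ * ∏ i : Fin k, w3 T (m 0) (m i.succ) := by
          refine Finset.sum_le_sum_of_subset_of_nonneg ((Finset.filter_subset _ _).trans (box_subset_boxP T)) ?_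
          intro m _ _
          have := Finset.prod_nonneg fun (i : Fin k) (_ : i ∈ (Finset.univ : Finset (Fin k))) ↦ (w3_pos hL0 (m 0) (m i.succ)).le
          exact mul_nonneg (mul_nonneg hCr0 hτ0) this
      _ = Cr * τ * ∑ m ∈ boxP k T, ∏ i : Fin k, w3 T (m 0) (m i.succ) := by rw [Finset.mul_sum]
  · -- (t2)
    calc ∑ m ∈ Bx.filter (fun m ↦ ¬ low m ∧ ¬ near m), ‖gT Φ m - fT Φ T m‖
        ≤ ∑ _m ∈ Bx.filter (fun m ↦ ¬ low m ∧ ¬ near m), Ca * (δ + δ') :=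
          Finset.sum_le_sum fun m hm ↦ by
            rw [Finset.mem_filter] at hm; exact ht2 m hm.1 hm.2.1 hm.2.2
      _ = ((Bx.filter fun m ↦ ¬ low m ∧ ¬ near m).card : ℝ) * (Ca * (δ + δ')) := by rw [Finset.sum_const, nsmul_eq_mul]
      _ ≤ (N : ℝ) ^ (k + 1) * (Ca * (δ + δ')) := by
          refine mul_le_mul_of_nonneg_right ?_ (by positivity)
          have h1 : ((Bx.filter fun m ↦ ¬ low m ∧ ¬ near m).card : ℝ) ≤ Bx.card := by
            exact_mod_cast Finset.card_le_card (Finset.filter_subset _ _)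
          refine h1.trans (le_of_eq ?_)
          simp only [Bx, box, Fintype.card_piFinset, Finset.card_range, Finset.prod_const, Finset.card_univ, Fintype.card_fin]
          push_cast; rfl
  · -- (t3)
    have hcons : (fun _ : Fin (k + 1) ↦ Finset.range N) = (Fin.cons (Finset.range N) (fun _ : Fin k ↦ Finset.range N) : Fin (k + 1) → Finset ℕ) := by
      funext j; refine Fin.cases (by simp) (fun i ↦ by simp) j
    set lowA : Finset ℕ := (Finset.range N).filter fun a ↦ zetaOrdinate a < 2 * Tl
    calc ∑ m ∈ Bx.filter (fun m ↦ low m), ‖gT Φ m - fT Φ T m‖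
        ≤ ∑ m ∈ Bx.filter (fun m ↦ low m), (C₃ * ∏ i : Fin k, wt3 (m 0) (m i.succ) + C₃ * ∏ i : Fin k, w3 T (m 0) (m i.succ)) :=
          Finset.sum_le_sum fun m _ ↦ ht3 m
      _ = ∑ m ∈ Bx, if low m then (C₃ * ∏ i : Fin k, wt3 (m 0) (m i.succ) + C₃ * ∏ i : Fin k, w3 T (m 0) (m i.succ)) else 0 := by
          rw [Finset.sum_filter]
      _ = ∑ a ∈ Finset.range N, ∑ u ∈ Fintype.piFinset (fun _ : Fin k ↦ Finset.range N),
            if zetaOrdinate a < 2 * Tl then (C₃ * ∏ i : Fin k, wt3 a (u i) + C₃ * ∏ i : Fin k, w3 T a (u i)) else 0 := by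
          simp only [Bx, box]
          rw [hcons, sum_piFinset_cons]
          rfl
      _ = ∑ a ∈ lowA, ∑ u ∈ Fintype.piFinset (fun _ : Fin k ↦ Finset.range N),
            (C₃ * ∏ i : Fin k, wt3 a (u i) + C₃ * ∏ i : Fin k, w3 T a (u i)) := by
          simp only [lowA]
          rw [Finset.sum_filter]
          refine Finset.sum_congr rfl fun a _ ↦ ?_
          split_ifs with h
          · rfl
          · exact Finset.sum_const_zero
      _ = ∑ a ∈ lowA, (C₃ * (∑ n ∈ Finset.range N, wt3 a n) ^ k + C₃ * (∑ n ∈ Finset.range N, w3 T a n) ^ k) := by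
          refine Finset.sum_congr rfl fun a _ ↦ ?_
          rw [Finset.sum_add_distrib, ← Finset.mul_sum, ← Finset.mul_sum,
            sum_piFinset_prod (fun _ : Fin k ↦ Finset.range N) (fun _ n ↦ wt3 a n),
            sum_piFinset_prod (fun _ : Fin k ↦ Finset.range N) (fun _ n ↦ w3 T a n)]
          simp only [Finset.prod_const, Finset.card_univ, Fintype.card_fin]
      _ ≤ ∑ _a ∈ lowA, (C₃ * (6 * Bt) ^ k + C₃ * (6 * B) ^ k) := by
          refine Finset.sum_le_sum fun a _ ↦ add_le_add ?_ ?_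
          · refine mul_le_mul_of_nonneg_left (pow_le_pow_left₀ (Finset.sum_nonneg fun n _ ↦ ?_) (hshellt a) _) hC₃0
            unfold wt3; positivity
          · exact mul_le_mul_of_nonneg_left (pow_le_pow_left₀ (Finset.sum_nonneg fun n _ ↦ (w3_pos hL0 a n).le) (hshell a) _) hC₃0
      _ = (lowA.card : ℝ) * (C₃ * ((6 * B) ^ k + (6 * Bt) ^ k)) := by rw [Finset.sum_const, nsmul_eq_mul]; ring

/-! ## The renormalisation estimate -/

set_option maxHeartbeats 800000 in
/-- **Renormalisation** (Rudnick–Sarnak 1996, (3.75)–(3.77), at every level; RH): for `Φ` smooth of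
compact support and `ε > 0` there is `T₀` with
`‖Σ_{m ∈ [0,N(T))ⁿ} f_Φ(γ̃_m) − Σ_{m ∈ [0,N(T))ⁿ} f_Φ(Lγ_m/2π)‖ ≤ ε T log T` for `T ≥ T₀`.
[cite: RudnickSarnak1996, Thm. 3.2, (3.75)–(3.77)] -/
theorem exists_norm_sharpN_sub_sharpL_le (hRH : RiemannHypothesis) {Φ : (Fin (k + 1) → ℝ) → ℂ}
    (hd : ContDiff ℝ ∞ Φ) (hs : HasCompactSupport Φ) {ε : ℝ} (hε : 0 < ε) :
    ∃ T₀ : ℝ, ∀ T : ℝ, T₀ ≤ T → ‖sharpN Φ T - sharpL Φ T‖ ≤ ε * T * Real.log T := by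
  classical
  -- data
  obtain ⟨CK, hCK, TK, hTK3, hkey⟩ := exists_sum_boxP_prod_w3_le hRH k
  obtain ⟨C₁, hC₁, T₁, hunit⟩ := exists_unitWindow_le
  obtain ⟨Cw, hCw, Tw, hwinN⟩ := RudnickSarnak.exists_zetaZeroCount_window_le
  obtain ⟨C₃, hC₃0, hC₃⟩ := exists_norm_psiFn_le_prod hd hs 3
  obtain ⟨Ca, hCa0, hCa⟩ := exists_norm_psiFn_le_prod hd hs (k + 2)
  obtain ⟨Cr, hCr0, hCr⟩ := exists_norm_psiFn_sub_le hd hs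
  obtain ⟨CN, hCN, hNev⟩ := riemann_von_mangoldt_holds.eventually_le_mul
  obtain ⟨TN, hTN⟩ := eventually_atTop.1 hNev
  -- constants of the three terms (as functions of `L = log T` and `T`)
  -- term 1: `Cr τ CK T L` with `τ = ((k+2) log L + 1)/L`
  -- term 2: `(CN T L)^{k+1} Ca (δ + δ')` with `δ, δ' ≤ (2π L^{k+2}/T)^{k+2}`
  -- term 3: `N(2 T_l) C₃ 2 (6 (C₁+Cw) L)^k` with `N(2T_l) ≤ CN (2T_l) L`, `T_l = T/L^{k+2}`
  have hT_ev : ∀ᶠ T : ℝ in atTop,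
      Cr * (((k + 2) * Real.log (Real.log T) + 1) / Real.log T) * CK ≤ ε / 3 ∧
      ((k + 2) * Real.log (Real.log T) + 1) / Real.log T ≤ 1 / 2 ∧
      (CN * T * Real.log T) ^ (k + 1) * (Ca * (2 * (2 * π * Real.log T ^ (k + 2) / T) ^ (k + 2))) ≤ ε / 3 * T * Real.log T ∧
      CN * (2 * (T / Real.log T ^ (k + 2))) * Real.log T * (C₃ * (2 * (6 * ((C₁ + Cw) * Real.log T)) ^ k)) ≤ ε / 3 * T * Real.log T ∧
      max TN 1 ≤ 2 * (T / Real.log T ^ (k + 2)) := by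
    -- the basic limit `((k+2) log L + 1)/L → 0` along `L = log T → ∞`
    have hlim0 : Tendsto (fun L : ℝ ↦ ((k + 2) * Real.log L + 1) / L) atTop (𝓝 0) := by
      have ha := Real.tendsto_pow_log_div_mul_add_atTop 1 0 1 one_ne_zero
      have hb : Tendsto (fun L : ℝ ↦ 1 / L) atTop (𝓝 0) := tendsto_const_nhds.div_atTop tendsto_id
      have := (ha.const_mul ((k : ℝ) + 2)).add hb
      rw [mul_zero, zero_add] at this
      refine this.congr' ?_
      filter_upwards [eventually_ne_atTop (0 : ℝ)] with L hL
      simp only [pow_one, one_mul, add_zero]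
      field_simp
    have hlim : Tendsto (fun T : ℝ ↦ ((k + 2) * Real.log (Real.log T) + 1) / Real.log T) atTop (𝓝 0) :=
      hlim0.comp Real.tendsto_log_atTop
    refine (?_ : ∀ᶠ T : ℝ in atTop, _).and ((?_ : ∀ᶠ T : ℝ in atTop, _).and ((?_ : ∀ᶠ T : ℝ in atTop, _).and
      ((?_ : ∀ᶠ T : ℝ in atTop, _).and ?_)))
    · have h := (hlim.const_mul Cr).mul_const CK
      rw [mul_zero, zero_mul] at h
      exact ((tendsto_order.1 h).2 (ε / 3) (by positivity)).mono fun T hT ↦ hT.le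
    · exact ((tendsto_order.1 hlim).2 (1 / 2) (by norm_num)).mono fun T hT ↦ hT.le
    · -- `C' L^p / T ≤ ε/3 T L`
      set C' : ℝ := CN ^ (k + 1) * Ca * 2 * (2 * π) ^ (k + 2)
      have hC' : 0 ≤ C' := by positivity
      set p : ℕ := (k + 1) + (k + 2) * (k + 2)
      filter_upwards [eventually_log_pow_le p (ε := ε / 3 / (C' + 1)) (by positivity), eventually_ge_atTop (Real.exp 1)]
        with T hT hTe
      have hT0 : 0 < T := lt_of_lt_of_le (Real.exp_pos 1) hTe
      have hL1 : 1 ≤ Real.log T := by rw [Real.le_log_iff_exp_le hT0]; exact hTe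
      have hT1 : 1 ≤ T := le_trans (by linarith [Real.add_one_le_exp (1 : ℝ)]) hTe
      set L := Real.log T
      have e : (CN * T * L) ^ (k + 1) * (Ca * (2 * (2 * π * L ^ (k + 2) / T) ^ (k + 2))) = C' * L ^ p / T := by
        have hT0' : T ≠ 0 := hT0.ne'
        set P1 : ℝ := L ^ (k + 1)
        set P2 : ℝ := L ^ ((k + 2) * (k + 2))
        set TT : ℝ := T ^ (k + 1)
        have hTT : T ^ (k + 2) = TT * T := pow_succ T (k + 1)
        have hP : L ^ p = P1 * P2 := pow_add L (k + 1) ((k + 2) * (k + 2))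
        have h1 : (CN * T * L) ^ (k + 1) = CN ^ (k + 1) * TT * P1 := by simp only [TT, P1]; rw [mul_pow, mul_pow]
        have h2 : (2 * π * L ^ (k + 2) / T) ^ (k + 2) = (2 * π) ^ (k + 2) * P2 / (TT * T) := by
          rw [div_pow, mul_pow, ← pow_mul, hTT]
        rw [h1, h2, hP]
        simp only [C']
        have hTT0 : TT ≠ 0 := pow_ne_zero _ hT0'
        field_simp
      rw [e]
      have h1 : C' * L ^ p ≤ (C' + 1) * (ε / 3 / (C' + 1) * T) := mul_le_mul (by linarith) hT (by positivity) (by positivity)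
      have h2 : (C' + 1) * (ε / 3 / (C' + 1) * T) = ε / 3 * T := by field_simp
      rw [div_le_iff₀ hT0]
      calc C' * L ^ p ≤ ε / 3 * T := by linarith
        _ = ε / 3 * T * 1 * 1 := by ring
        _ ≤ ε / 3 * T * L * T := by gcongr
    · -- `C'' T / L ≤ ε/3 T L`
      set C'' : ℝ := CN * 2 * C₃ * 2 * (6 * (C₁ + Cw)) ^ k
      have hC'' : 0 ≤ C'' := by positivity
      have hL_ev : ∀ᶠ T : ℝ in atTop, Real.sqrt (3 * C'' / ε) + 1 ≤ Real.log T :=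
        Real.tendsto_log_atTop.eventually_ge_atTop _
      filter_upwards [hL_ev, eventually_gt_atTop (0 : ℝ)] with T hTL hT0
      set L := Real.log T
      have hL0 : 0 < L := lt_of_lt_of_le (by positivity) hTL
      have hsq : 3 * C'' / ε ≤ L ^ 2 := by
        have h1 : Real.sqrt (3 * C'' / ε) ≤ L := by linarith
        have h2 := Real.sq_sqrt (show 0 ≤ 3 * C'' / ε by positivity)
        nlinarith [Real.sqrt_nonneg (3 * C'' / ε)]
      have e : CN * (2 * (T / L ^ (k + 2))) * L * (C₃ * (2 * (6 * ((C₁ + Cw) * L)) ^ k)) = C'' * T / L := by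
        set Pk : ℝ := L ^ k
        have hLk2 : L ^ (k + 2) = Pk * L * L := by simp only [Pk]; rw [pow_succ, pow_succ]
        have h6 : (6 * ((C₁ + Cw) * L)) ^ k = (6 * (C₁ + Cw)) ^ k * Pk := by simp only [Pk]; rw [← mul_pow]; ring_nf
        rw [hLk2, h6]
        simp only [C'']
        have hPk : Pk ≠ 0 := pow_ne_zero _ hL0.ne'
        field_simp
      rw [e, div_le_iff₀ hL0]
      rw [div_le_iff₀ hε] at hsq
      have : C'' * T * 3 ≤ ε * T * L * L := by nlinarith
      nlinarith
    · filter_upwards [eventually_log_pow_le (k + 2) (ε := 1 / (2 * max TN 1)) (by positivity), eventually_gt_atTop (1 : ℝ)]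
        with T hT hT1
      have hL : 0 < Real.log T ^ (k + 2) := pow_pos (Real.log_pos hT1) _
      rw [mul_div_assoc', le_div_iff₀ hL]
      have hm : 0 < max TN 1 := lt_of_lt_of_le one_pos (le_max_right _ _)
      have hT0 : 0 ≤ T := by linarith
      calc max TN 1 * Real.log T ^ (k + 2) ≤ max TN 1 * (1 / (2 * max TN 1) * T) := mul_le_mul_of_nonneg_left hT hm.le
        _ = T / 2 := by field_simp
        _ ≤ 2 * T := by linarith
  obtain ⟨T₂, hT₂⟩ := eventually_atTop.1 hT_ev
  refine ⟨max (max (max TK T₁) (max Tw 3)) (max T₂ (Real.exp (2 * π))), fun T hT ↦ ?_⟩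
  have hTK : TK ≤ T := le_trans (le_trans (le_trans (le_max_left _ _) (le_max_left _ _)) (le_max_left _ _)) hT
  have hT1' : T₁ ≤ T := le_trans (le_trans (le_trans (le_max_right _ _) (le_max_left _ _)) (le_max_left _ _)) hT
  have hTw : Tw ≤ T := le_trans (le_trans (le_trans (le_max_left _ _) (le_max_right _ _)) (le_max_left _ _)) hT
  have hT3 : (3 : ℝ) ≤ T := le_trans (le_trans (le_trans (le_max_right _ _) (le_max_right _ _)) (le_max_left _ _)) hT
  have hT2' : T₂ ≤ T := le_trans (le_trans (le_max_left _ _) (le_max_right _ _)) hT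
  have hTe : Real.exp (2 * π) ≤ T := le_trans (le_trans (le_max_right _ _) (le_max_right _ _)) hT
  have hT0 : (0 : ℝ) < T := by linarith
  set L := Real.log T with hLdef
  have hL2π : 2 * π ≤ L := by rw [hLdef, Real.le_log_iff_exp_le hT0]; exact hTe
  have hL1 : 1 ≤ L := le_trans (by linarith [Real.pi_gt_three]) hL2π
  have hL0 : 0 < L := by linarith
  obtain ⟨hE1, hτ, hE2, hE3, hE4⟩ := hT₂ T hT2'
  -- the parameters
  set Tl : ℝ := T / L ^ (k + 2)
  have hLk : 0 < L ^ (k + 2) := pow_pos hL0 _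
  have hTl : 0 < Tl := div_pos hT0 hLk
  have hLk1 : 1 ≤ L ^ (k + 2) := one_le_pow₀ hL1
  have h2Tl : 2 * Tl ≤ T := by
    -- `2 Tl = 2T/L^{k+2} ≤ T` iff `2 ≤ L^{k+2}`; we have `L ≥ 2π > 2`.
    have h2 : (2 : ℝ) ≤ L ^ (k + 2) :=
      le_trans (by linarith [Real.pi_gt_three] : (2 : ℝ) ≤ L) (le_self_pow₀ hL1 (by omega))
    simp only [Tl]
    rw [mul_div_assoc', div_le_iff₀ hLk]
    nlinarith
  have hTdiv : T / Tl = L ^ (k + 2) := by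
    simp only [Tl]; field_simp
  have hτ' : (Real.log (T / Tl) + 1) / L ≤ 1 / 2 := by
    rw [hTdiv, Real.log_pow]; push_cast; exact hτ
  -- window bounds
  have hB := hunit T hT1'
  have hBt : ∀ b : ℝ, (((Finset.range (zetaZeroCount T)).filter fun n ↦
      b ≤ normalizedOrdinate n ∧ normalizedOrdinate n ≤ b + 1).card : ℝ) ≤ Cw * L :=
    fun b ↦ RudnickSarnak.card_filter_normalizedOrdinate_window_le hT0.le (hwinN T hTw) b
  -- the explicit estimate
  have hmain := norm_sharpN_sub_sharpL_le_explicit (k := k) hC₃0 hC₃ hCa0 hCa hCr0 hCr hT3 hL2π hTl h2Tl hτ' hB hBt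
  refine hmain.trans ?_
  -- bound the three terms
  have hkeyT := hkey T hTK
  have hNT : (zetaZeroCount T : ℝ) ≤ CN * (T * L) := hTN T (le_trans (le_max_left _ _) (hE4.trans h2Tl))
  have hN2Tl : (((Finset.range (zetaZeroCount T)).filter fun a ↦ zetaOrdinate a < 2 * Tl).card : ℝ) ≤ CN * (2 * Tl) * L := by
    have hsub : ((Finset.range (zetaZeroCount T)).filter fun a ↦ zetaOrdinate a < 2 * Tl) ⊆ Finset.range (zetaZeroCount (2 * Tl)) := by
      intro a ha
      rw [Finset.mem_filter] at ha
      exact Finset.mem_range.2 (lt_zetaZeroCount_iff.2 ha.2.le)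
    have h1 : (((Finset.range (zetaZeroCount T)).filter fun a ↦ zetaOrdinate a < 2 * Tl).card : ℝ) ≤ zetaZeroCount (2 * Tl) := by
      have := Finset.card_le_card hsub
      rw [Finset.card_range] at this
      exact_mod_cast this
    have h2 : (zetaZeroCount (2 * Tl) : ℝ) ≤ CN * ((2 * Tl) * Real.log (2 * Tl)) := hTN (2 * Tl) (le_trans (le_max_left _ _) hE4)
    have h3 : Real.log (2 * Tl) ≤ L := Real.log_le_log (by positivity) h2Tl
    calc _ ≤ (zetaZeroCount (2 * Tl) : ℝ) := h1
      _ ≤ CN * ((2 * Tl) * Real.log (2 * Tl)) := h2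
      _ ≤ CN * ((2 * Tl) * L) := mul_le_mul_of_nonneg_left (mul_le_mul_of_nonneg_left h3 (by positivity)) hCN.le
      _ = CN * (2 * Tl) * L := by ring
  -- term 1
  have ht1 : Cr * ((Real.log (T / Tl) + 1) / L) * ∑ m ∈ boxP k T, ∏ i : Fin k, w3 T (m 0) (m i.succ) ≤ ε / 3 * (T * L) := by
    rw [hTdiv, Real.log_pow]
    push_cast
    have h0 : 0 ≤ Cr * (((k + 2) * Real.log L + 1) / L) := by
      have : 0 ≤ Real.log L := Real.log_nonneg hL1
      positivity
    calc Cr * ((((k : ℝ) + 2) * Real.log L + 1) / L) * ∑ m ∈ boxP k T, ∏ i : Fin k, w3 T (m 0) (m i.succ)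
        ≤ (Cr * ((((k : ℝ) + 2) * Real.log L + 1) / L)) * (CK * T * L) := mul_le_mul_of_nonneg_left hkeyT h0
      _ = (Cr * ((((k : ℝ) + 2) * Real.log L + 1) / L) * CK) * (T * L) := by ring
      _ ≤ ε / 3 * (T * L) := mul_le_mul_of_nonneg_right hE1 (by positivity)
  -- term 2
  have ht2 : (zetaZeroCount T : ℝ) ^ (k + 1) * (Ca * (((1 + L * Tl / (2 * π)) ^ (k + 2))⁻¹ + ((1 + Tl / π) ^ (k + 2))⁻¹)) ≤ ε / 3 * (T * L) := by
    -- `δ, δ' ≤ (2π L^{k+2}/T)^{k+2}`: indeed `1 + L Tl/2π ≥ L Tl/2π = T/(2π L^{k+1}) ≥ T/(2π L^{k+2})` and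
    -- `1 + Tl/π ≥ Tl/π = T/(π L^{k+2}) ≥ T/(2π L^{k+2})`.
    set q : ℝ := 2 * π * L ^ (k + 2) / T
    have hq : 0 < q := by positivity
    have hδ : ((1 + L * Tl / (2 * π)) ^ (k + 2))⁻¹ ≤ q ^ (k + 2) := by
      have h1 : q⁻¹ ≤ 1 + L * Tl / (2 * π) := by
        have e : L * Tl / (2 * π) = q⁻¹ * L := by
          simp only [Tl, q]; field_simp
        rw [e]
        have : q⁻¹ ≤ q⁻¹ * L := le_mul_of_one_le_right (by positivity) hL1
        linarith
      calc ((1 + L * Tl / (2 * π)) ^ (k + 2))⁻¹ ≤ ((q⁻¹) ^ (k + 2))⁻¹ :=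
            inv_anti₀ (by positivity) (pow_le_pow_left₀ (by positivity) h1 _)
        _ = q ^ (k + 2) := by rw [inv_pow, inv_inv]
    have hδ' : ((1 + Tl / π) ^ (k + 2))⁻¹ ≤ q ^ (k + 2) := by
      have h1 : q⁻¹ ≤ 1 + Tl / π := by
        have e : Tl / π = 2 * q⁻¹ := by
          simp only [Tl, q]; field_simp
        rw [e]
        have : 0 ≤ q⁻¹ := by positivity
        linarith
      calc ((1 + Tl / π) ^ (k + 2))⁻¹ ≤ ((q⁻¹) ^ (k + 2))⁻¹ :=
            inv_anti₀ (by positivity) (pow_le_pow_left₀ (by positivity) h1 _)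
        _ = q ^ (k + 2) := by rw [inv_pow, inv_inv]
    calc (zetaZeroCount T : ℝ) ^ (k + 1) * (Ca * (((1 + L * Tl / (2 * π)) ^ (k + 2))⁻¹ + ((1 + Tl / π) ^ (k + 2))⁻¹))
        ≤ (CN * T * L) ^ (k + 1) * (Ca * (q ^ (k + 2) + q ^ (k + 2))) := by
          refine mul_le_mul (pow_le_pow_left₀ (Nat.cast_nonneg _) (by rw [mul_assoc]; exact hNT) _) ?_ (by positivity) (by positivity)
          exact mul_le_mul_of_nonneg_left (add_le_add hδ hδ') hCa0
      _ = (CN * T * L) ^ (k + 1) * (Ca * (2 * (2 * π * L ^ (k + 2) / T) ^ (k + 2))) := by simp only [q]; ring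
      _ ≤ ε / 3 * T * L := hE2
      _ = ε / 3 * (T * L) := by ring
  -- term 3
  have ht3 : (((Finset.range (zetaZeroCount T)).filter fun a ↦ zetaOrdinate a < 2 * Tl).card : ℝ) *
      (C₃ * ((6 * (C₁ * L)) ^ k + (6 * (Cw * L)) ^ k)) ≤ ε / 3 * (T * L) := by
    have h1 : (6 * (C₁ * L)) ^ k + (6 * (Cw * L)) ^ k ≤ 2 * (6 * ((C₁ + Cw) * L)) ^ k := by
      have ha : (6 * (C₁ * L)) ^ k ≤ (6 * ((C₁ + Cw) * L)) ^ k :=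
        pow_le_pow_left₀ (by positivity) (by nlinarith) _
      have hb : (6 * (Cw * L)) ^ k ≤ (6 * ((C₁ + Cw) * L)) ^ k :=
        pow_le_pow_left₀ (by positivity) (by nlinarith) _
      linarith
    calc _ ≤ (CN * (2 * Tl) * L) * (C₃ * (2 * (6 * ((C₁ + Cw) * L)) ^ k)) :=
          mul_le_mul hN2Tl (mul_le_mul_of_nonneg_left h1 hC₃0) (by positivity) (by positivity)
      _ = CN * (2 * (T / L ^ (k + 2))) * L * (C₃ * (2 * (6 * ((C₁ + Cw) * L)) ^ k)) := by simp only [Tl]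
      _ ≤ ε / 3 * T * L := hE3
      _ = ε / 3 * (T * L) := by ring
  have e : ε * T * L = ε / 3 * (T * L) + ε / 3 * (T * L) + ε / 3 * (T * L) := by ring
  rw [e]
  exact add_le_add (add_le_add ht1 ht2) ht3

end Unsmooth

end RudnickSarnakN

end Literature.NumberTheory.LFunctions

end
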